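import Summits.Ventures.Crystal3D.Theorems.StickyWulffConstantPolycrystalWulffBoundAggRows

/-!
# `PolycrystalWulffBound`, line `PolyDensity`: combinatorial preliminaries for the all-`m` induction

Route `StickyWulffConstant` of the venture `Summits/Ventures/Crystal3D`, crux `PolycrystalWulffBound`
(item `stmt-Ventures-19482`), second prover lane (poly-p2, gen 4).  The aggregated middle-band argument
(memo `poly-p2/MIDDLE-BAND-g4.md` §12–13, catalogue `poly-p2/AGG-CATALOGUE.md`) runs by strong induction on the
number of lattice classes and singles out the three largest classes.  Two generic bricks:

* `exists_top_three` — in a finite type with at least three elements, a weight `v` has three distinct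
  elements `i₁, i₂, i₃` with `v i₃ ≤ v i₂ ≤ v i₁` dominating every other element (`v j ≤ v i₃`);
* `card_image_recolour_lt` — recolouring a non-empty, class-closed set `S` of grains to the label of a grain
  `ℓ₀ ∉ S` strictly decreases the number of distinct labels (the induction step of `recolour_move` /
  `delete_move`).
WHAT THIS IS NOT: the induction itself; F-C1 not moved.
-/

namespace Summit.Ventures.Crystal3D.Theorems

open Finset

/-- Three largest elements of a weight on a finite type with at least three elements. -/
theorem exists_top_three {β : Type*} [Fintype β] [DecidableEq β] (v : β → ℝ) (h3 : 3 ≤ Fintype.card β) :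
    ∃ i₁ i₂ i₃ : β, i₁ ≠ i₂ ∧ i₂ ≠ i₃ ∧ i₁ ≠ i₃ ∧ v i₂ ≤ v i₁ ∧ v i₃ ≤ v i₂ ∧
      ∀ j, j ≠ i₁ → j ≠ i₂ → j ≠ i₃ → v j ≤ v i₃ := by
  have hne₁ : (univ : Finset β).Nonempty := by
    rw [univ_nonempty_iff, ← Fintype.card_pos_iff]; omega
  obtain ⟨i₁, -, h₁⟩ := exists_max_image univ v hne₁
  have hne₂ : (univ.erase i₁).Nonempty := by
    rw [← card_pos, card_erase_of_mem (mem_univ _), card_univ]; omega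
  obtain ⟨i₂, hi₂, h₂⟩ := exists_max_image _ v hne₂
  have hne₃ : ((univ.erase i₁).erase i₂).Nonempty := by
    rw [← card_pos, card_erase_of_mem hi₂, card_erase_of_mem (mem_univ _), card_univ]; omega
  obtain ⟨i₃, hi₃, h₃⟩ := exists_max_image _ v hne₃
  have h21 : i₂ ≠ i₁ := (mem_erase.1 hi₂).1
  have h32 : i₃ ≠ i₂ := (mem_erase.1 hi₃).1
  have h31 : i₃ ≠ i₁ := (mem_erase.1 (mem_erase.1 hi₃).2).1
  refine ⟨i₁, i₂, i₃, h21.symm, h32.symm, h31.symm, h₁ i₂ (mem_univ _), h₂ i₃ (mem_erase.1 hi₃).2, ?_⟩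
  intro j hj₁ hj₂ _
  exact h₃ j (mem_erase.2 ⟨hj₂, mem_erase.2 ⟨hj₁, mem_univ _⟩⟩)

/-- Recolouring a non-empty class-closed set of grains `S` to the label of `ℓ₀ ∉ S` strictly decreases the
number of distinct labels. -/
theorem card_image_recolour_lt {n : ℕ} {α : Type*} [DecidableEq α] (lat : Fin n → α) (S : Finset (Fin n))
    (ℓ₀ : Fin n) (hℓ₀ : ℓ₀ ∉ S) (hS : ∀ f g, lat f = lat g → f ∈ S → g ∈ S) (hne : S.Nonempty) :
    (univ.image fun f => if f ∈ S then lat ℓ₀ else lat f).card < (univ.image lat).card := by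
  obtain ⟨f₀, hf₀⟩ := hne
  apply card_lt_card
  rw [ssubset_iff_of_subset]
  · refine ⟨lat f₀, mem_image_of_mem _ (mem_univ _), ?_⟩
    intro h
    obtain ⟨g, -, hg⟩ := mem_image.1 h
    by_cases hgS : g ∈ S
    · rw [if_pos hgS] at hg
      exact hℓ₀ (hS f₀ ℓ₀ hg.symm hf₀)
    · rw [if_neg hgS] at hg
      exact hgS (hS f₀ g hg.symm hf₀)
  · intro a ha
    obtain ⟨g, -, hg⟩ := mem_image.1 ha
    by_cases hgS : g ∈ S
    · rw [if_pos hgS] at hg; rw [← hg]; exact mem_image_of_mem _ (mem_univ _)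
    · rw [if_neg hgS] at hg; rw [← hg]; exact mem_image_of_mem _ (mem_univ _)

end Summit.Ventures.Crystal3D.Theorems
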